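import Summits.Ventures.WeilGRH.FrontierDoubleRungs
import Summits.Ventures.WeilGRH.CensusDoubleReflectionValues
import HarnessLib

/-!
# GRH arm (rh-explicit, venture WeilGRH): the `ζ` frontier `4023/5000` for NAMED census characters

Cell `rh-explicit`, WEIL TRACK — GRH ARM, seat weil-grh-2 (gen3). Discharge of the hypotheses of the frontier
double-transfer theorems of `FrontierDoubleRungs.lean` for the named primitive characters of the census
`DirichletCharacterCensus20.lean` (`censusRow q n` = Conrey label `q.n`): every cell below is the tree theorem
`WeilPositivityOnChar χ (4023/5000)` — Weil positivity for `L(s, χ)` on `[-t, t]` at the largest `t` for which it is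
kernel-checked for `ζ` itself — hence also the rungs `18/25` and `3/4` (`WeilPositivityOnChar.mono`):
* `12.11` (`χ(2) = χ(3) = 0`), `13.12` (`χ(2) = −1`, `χ(3) = 1`), `16.3, 16.11, 16.5, 16.13` (`χ(2) = 0`, `χ(3) = ±i`),
  `17.4, 17.13` (`χ(2) = −1`, `χ(3) = ±i`), `19.18` (`χ(2) = −1`), `20.3, 20.7, 20.19` (even modulus `≥ 18`).
Before this file the only census class PROVED at the frontier was `17.16` (`FrontierTrivialAtTwo`). No named facts.
-/

noncomputable section

open Complex
open scoped Real ComplexConjugate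

namespace Summit.Ventures.WeilGRH

open Literature.NumberTheory.LFunctions

/-- **Cell 12.11 at `4023/5000`** (`χ(2) = χ(3) = 0`). -/
theorem weilPositivityOnChar_frontier_census_12_11 :
    WeilPositivityOnChar ((censusRow 12 11).toChar (census20_check _ (by decide))) (4023 / 5000) := by
  have h2 : (censusRow 12 11).toChar (census20_check _ (by decide)) (2 : ZMod _) = 0 := by
    rw [two_eq_natCast'']; exact censusRow_toChar_natCast_eq_zero _ 2 (by decide)
  have h3 : (censusRow 12 11).toChar (census20_check _ (by decide)) (3 : ZMod _) = 0 := by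
    rw [three_eq_natCast'']; exact censusRow_toChar_natCast_eq_zero _ 3 (by decide)
  exact weilPositivityOnChar_frontier_of_six_dvd_ge_twelve (by decide) _ h2 h3

/-- **Cell 13.12 at `4023/5000`** (`χ(2) = −1`, `χ(3) = 1`). -/
theorem weilPositivityOnChar_frontier_census_13_12 :
    WeilPositivityOnChar ((censusRow 13 12).toChar (census20_check _ (by decide))) (4023 / 5000) :=
  weilPositivityOnChar_frontier_class_13_12 (by decide) _ census_13_12_two census_13_12_three

/-- **Cell 16.3 at `4023/5000`** (`χ(2) = 0`, `χ(3) = e(3/4)`). -/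
theorem weilPositivityOnChar_frontier_census_16_3 :
    WeilPositivityOnChar ((censusRow 16 3).toChar (census20_check _ (by decide))) (4023 / 5000) := by
  have h2 : (censusRow 16 3).toChar (census20_check _ (by decide)) (2 : ZMod _) = 0 := by
    rw [two_eq_natCast'']; exact censusRow_toChar_natCast_eq_zero _ 2 (by decide)
  have h3 : ‖1 - (censusRow 16 3).toChar (census20_check _ (by decide)) (3 : ZMod _)‖ ^ 2 = 2 := by
    rw [three_eq_natCast'', normSq_one_sub_censusChar _ 3 (by decide), show (censusRow 16 3).e 3 = 3 by decide,
      show (censusRow 16 3).ord = 4 by decide]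
    exact twoSubTwoCos_3_4
  exact weilPositivityOnChar_frontier_class_16_3 (by decide) _ h2 h3

/-- **Cell 16.11 at `4023/5000`** (`χ(2) = 0`, `χ(3) = e(1/4)`). -/
theorem weilPositivityOnChar_frontier_census_16_11 :
    WeilPositivityOnChar ((censusRow 16 11).toChar (census20_check _ (by decide))) (4023 / 5000) := by
  have h2 : (censusRow 16 11).toChar (census20_check _ (by decide)) (2 : ZMod _) = 0 := by
    rw [two_eq_natCast'']; exact censusRow_toChar_natCast_eq_zero _ 2 (by decide)
  have h3 : ‖1 - (censusRow 16 11).toChar (census20_check _ (by decide)) (3 : ZMod _)‖ ^ 2 = 2 := by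
    rw [three_eq_natCast'', normSq_one_sub_censusChar _ 3 (by decide), show (censusRow 16 11).e 3 = 1 by decide,
      show (censusRow 16 11).ord = 4 by decide]
    exact twoSubTwoCos_1_4
  exact weilPositivityOnChar_frontier_class_16_3 (by decide) _ h2 h3

/-- **Cell 16.5 at `4023/5000`** (`χ(2) = 0`, `χ(3) = e(3/4)`). -/
theorem weilPositivityOnChar_frontier_census_16_5 :
    WeilPositivityOnChar ((censusRow 16 5).toChar (census20_check _ (by decide))) (4023 / 5000) := by
  have h2 : (censusRow 16 5).toChar (census20_check _ (by decide)) (2 : ZMod _) = 0 := by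
    rw [two_eq_natCast'']; exact censusRow_toChar_natCast_eq_zero _ 2 (by decide)
  have h3 : ‖1 - (censusRow 16 5).toChar (census20_check _ (by decide)) (3 : ZMod _)‖ ^ 2 = 2 := by
    rw [three_eq_natCast'', normSq_one_sub_censusChar _ 3 (by decide), show (censusRow 16 5).e 3 = 3 by decide,
      show (censusRow 16 5).ord = 4 by decide]
    exact twoSubTwoCos_3_4
  exact weilPositivityOnChar_frontier_class_16_3 (by decide) _ h2 h3

/-- **Cell 16.13 at `4023/5000`** (`χ(2) = 0`, `χ(3) = e(1/4)`). -/
theorem weilPositivityOnChar_frontier_census_16_13 :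
    WeilPositivityOnChar ((censusRow 16 13).toChar (census20_check _ (by decide))) (4023 / 5000) := by
  have h2 : (censusRow 16 13).toChar (census20_check _ (by decide)) (2 : ZMod _) = 0 := by
    rw [two_eq_natCast'']; exact censusRow_toChar_natCast_eq_zero _ 2 (by decide)
  have h3 : ‖1 - (censusRow 16 13).toChar (census20_check _ (by decide)) (3 : ZMod _)‖ ^ 2 = 2 := by
    rw [three_eq_natCast'', normSq_one_sub_censusChar _ 3 (by decide), show (censusRow 16 13).e 3 = 1 by decide,
      show (censusRow 16 13).ord = 4 by decide]
    exact twoSubTwoCos_1_4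
  exact weilPositivityOnChar_frontier_class_16_3 (by decide) _ h2 h3

/-- **Cell 17.4 at `4023/5000`** (`χ(2) = −1`, `χ(3) = e(3/4)`). -/
theorem weilPositivityOnChar_frontier_census_17_4 :
    WeilPositivityOnChar ((censusRow 17 4).toChar (census20_check _ (by decide))) (4023 / 5000) := by
  have h3 : ‖1 - (censusRow 17 4).toChar (census20_check _ (by decide)) (3 : ZMod _)‖ ^ 2 = 2 := by
    rw [three_eq_natCast'', normSq_one_sub_censusChar _ 3 (by decide), show (censusRow 17 4).e 3 = 3 by decide,
      show (censusRow 17 4).ord = 4 by decide]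
    exact twoSubTwoCos_3_4
  exact weilPositivityOnChar_frontier_class_17_4 (by decide) _ census_17_4_two h3

/-- **Cell 17.13 at `4023/5000`** (`χ(2) = −1`, `χ(3) = e(1/4)`). -/
theorem weilPositivityOnChar_frontier_census_17_13 :
    WeilPositivityOnChar ((censusRow 17 13).toChar (census20_check _ (by decide))) (4023 / 5000) := by
  have h3 : ‖1 - (censusRow 17 13).toChar (census20_check _ (by decide)) (3 : ZMod _)‖ ^ 2 = 2 := by
    rw [three_eq_natCast'', normSq_one_sub_censusChar _ 3 (by decide), show (censusRow 17 13).e 3 = 1 by decide,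
      show (censusRow 17 13).ord = 4 by decide]
    exact twoSubTwoCos_1_4
  exact weilPositivityOnChar_frontier_class_17_4 (by decide) _ census_17_13_two h3

/-- **Cell 19.18 at `4023/5000`** (`χ(2) = −1`, modulus `≥ 18`). -/
theorem weilPositivityOnChar_frontier_census_19_18 :
    WeilPositivityOnChar ((censusRow 19 18).toChar (census20_check _ (by decide))) (4023 / 5000) :=
  weilPositivityOnChar_frontier_of_chi_two_neg_one_ge_eighteen (by decide) _ census_19_18_two

/-- **Cell 20.3 at `4023/5000`** (even modulus `≥ 18`). -/
theorem weilPositivityOnChar_frontier_census_20_3 :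
    WeilPositivityOnChar ((censusRow 20 3).toChar (census20_check _ (by decide))) (4023 / 5000) := by
  have h2 : (censusRow 20 3).toChar (census20_check _ (by decide)) (2 : ZMod _) = 0 := by
    rw [two_eq_natCast'']; exact censusRow_toChar_natCast_eq_zero _ 2 (by decide)
  exact weilPositivityOnChar_frontier_of_even_ge_eighteen (by decide) _ h2

/-- **Cell 20.7 at `4023/5000`** (even modulus `≥ 18`). -/
theorem weilPositivityOnChar_frontier_census_20_7 :
    WeilPositivityOnChar ((censusRow 20 7).toChar (census20_check _ (by decide))) (4023 / 5000) := by
  have h2 : (censusRow 20 7).toChar (census20_check _ (by decide)) (2 : ZMod _) = 0 := by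
    rw [two_eq_natCast'']; exact censusRow_toChar_natCast_eq_zero _ 2 (by decide)
  exact weilPositivityOnChar_frontier_of_even_ge_eighteen (by decide) _ h2

/-- **Cell 20.19 at `4023/5000`** (even modulus `≥ 18`). -/
theorem weilPositivityOnChar_frontier_census_20_19 :
    WeilPositivityOnChar ((censusRow 20 19).toChar (census20_check _ (by decide))) (4023 / 5000) := by
  have h2 : (censusRow 20 19).toChar (census20_check _ (by decide)) (2 : ZMod _) = 0 := by
    rw [two_eq_natCast'']; exact censusRow_toChar_natCast_eq_zero _ 2 (by decide)
  exact weilPositivityOnChar_frontier_of_even_ge_eighteen (by decide) _ h2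

end Summit.Ventures.WeilGRH
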